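import Summits.ResolutionOfSingularities.ResolutionOfSingularities.Theorems.RadicialJungCleanModelsF75cCurveStepGood
import Summits.ResolutionOfSingularities.ResolutionOfSingularities.Theorems.RadicialJungCleanModelsF75cCurveLoop
import HarnessLib

/-!
# [F-75c discharge, brick C4] The successor of a GOOD configuration under the blow-up of a point on it is GOOD
# (The Stacks Project, Lemma 54.15.6 = Tag 0BIC, proof ¶2: «we see that `Y'_1, …, Y'_r` do not meet in points above `p`
# and `m_{q_i}(Y'_i, E) = 1`»)

Cell res-hironaka, D-0154 INPUTS discharger `res-inputs-p-f75c` for the named fact F-75c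
`Literature.AlgebraicGeometry.Resolution.Stacks0BIC_embeddedResolutionCurvesInSurfaces_locus`
(`--supports stmt-ResolutionOfSingularities-15917 --as helper`). A configuration `𝒞` of members (`cl{η}`, `η` not
closed, `dim 𝒪_{Y,η} = 1`) on `Y` is GOOD when every member is regular (its reduced subscheme) and any two distinct
members meet transversally at every common point (`𝓘_{C,q} + 𝓘_{C',q} = 𝔪_q`) — the end state of brick L1
(`F75c.exists_noBadPoint`). This file packages ONE blow-up at a closed point `x` lying on a member:

* `good_of_noBadPoint` — «no bad point» ⇒ GOOD;
* `isClosed_of_mem_inter` — a common point of two distinct members is a closed point;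
* `successor_state` — the successor configuration `{cl(π⁻¹(C ∖ {x}))} ∪ {π⁻¹{x}}`: reachable (composition of point
  blow-ups over `⋃ 𝒞₀`), finite, members, `⋃ 𝒞' = (π ≫ σ)⁻¹(⋃ 𝒞₀)` (bricks C1);
* **`good_successor`** — if `𝒞` is GOOD then so is the successor (bricks C2, C3).

HONEST FRAMING: bookkeeping over this seat's bricks C1–C3 and tree theorems; nothing here is a statement of
[Hironaka2017]. AI-written; AI review is weaker than expert review. References: The Stacks Project, Tag 0BIC [StacksProject].
-/

noncomputable section

set_option linter.dupNamespace false -- mandated namespace of this single-conjunct summit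

open CategoryTheory AlgebraicGeometry TopologicalSpace IsLocalRing

namespace Summit.ResolutionOfSingularities.ResolutionOfSingularities.Theorems

namespace F75c

open Literature.AlgebraicGeometry.Resolution
open Literature.AlgebraicGeometry.Resolution.CurveConfiguration
open Summit.ResolutionOfSingularities.ResolutionOfSingularities.Theorems.CP2008Prop44
open Scheme.IdealSheafData

universe u

/-! ## GOOD configurations -/

section Good

variable {Y : Scheme.{u}}

/-- **No bad point ⇒ GOOD**: every member is regular and distinct members meet transversally.
[cite: StacksProject, Tag 0BIC (Lemma 54.15.6, proof ¶2)] -/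
theorem good_of_noBadPoint {𝒞 : Set (Closeds Y)}
    (hno : ∀ x : Y, ¬ ∃ C ∈ 𝒞,
      x ∈ (vanishingIdeal C).subschemeι '' (Scheme.regularLocus (vanishingIdeal C).subscheme)ᶜ ∨
      (x ∈ (C : Set Y) ∧ ∃ C' ∈ 𝒞, C' ≠ C ∧ x ∈ (C' : Set Y) ∧
        stalkIdeal (vanishingIdeal C) x ⊔ stalkIdeal (vanishingIdeal C') x ≠ maximalIdeal (Y.presheaf.stalk x))) :
    (∀ C ∈ 𝒞, Scheme.IsRegular (vanishingIdeal C).subscheme) ∧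
      ∀ C ∈ 𝒞, ∀ C' ∈ 𝒞, C ≠ C' → ∀ q ∈ (C : Set Y) ∩ (C' : Set Y),
        stalkIdeal (vanishingIdeal C) q ⊔ stalkIdeal (vanishingIdeal C') q = maximalIdeal (Y.presheaf.stalk q) := by
  refine ⟨fun C hC => isRegular_subscheme_of_forall_not_mem C fun x _ h => hno x ⟨C, hC, Or.inl h⟩,
    fun C hC C' hC' hne q hq => ?_⟩
  by_contra h
  exact hno q ⟨C, hC, Or.inr ⟨hq.1, C', hC', hne.symm, hq.2, h⟩⟩

/-- **A common point of two distinct members is a closed point** (it is not the generic point of either).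
[cite: StacksProject, Tag 0BIC (Lemma 54.15.6, proof ¶2)] -/
theorem isClosed_of_mem_inter [IsNoetherian Y] (hqe : Scheme.IsQuasiExcellent Y) (hY2 : topologicalKrullDim Y ≤ 2)
    {𝒞 : Set (Closeds Y)}
    (hmem : ∀ C ∈ 𝒞, ∃ η : Y, (C : Set Y) = closure {η} ∧ ¬ IsClosed ({η} : Set Y) ∧
      ringKrullDim (Y.presheaf.stalk η) = 1)
    {x : Y} {C C' : Closeds Y} (hC : C ∈ 𝒞) (hC' : C' ∈ 𝒞) (hne : C ≠ C') (hxC : x ∈ (C : Set Y))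
    (hxC' : x ∈ (C' : Set Y)) : IsClosed ({x} : Set Y) := by
  by_cases htr : stalkIdeal (vanishingIdeal C) x ⊔ stalkIdeal (vanishingIdeal C') x = maximalIdeal (Y.presheaf.stalk x)
  swap
  · exact (isClosed_of_bad hqe hY2 hmem hC (Or.inr ⟨hxC, C', hC', hne.symm, hxC', htr⟩)).1
  -- transversal case: the same argument (the point is not the generic point of `C`)
  obtain ⟨η, hCη, hηcl, hη1⟩ := hmem C hC
  have hCeq : C = ⟨closure {η}, isClosed_closure⟩ := Closeds.ext hCη
  obtain ⟨hint, hnoeth, -, hdim1⟩ := member_props hqe hY2 hη1 hηcl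
  rw [← hCeq] at hint hnoeth hdim1
  haveI := hint; haveI := hnoeth
  obtain ⟨c, rfl⟩ := exists_subschemeι_eq C hxC
  refine isClosed_singleton_subschemeι_of_ne C hdim1 fun hc => hne ?_
  obtain ⟨η', hC'η', -, hη'1⟩ := hmem C' hC'
  rw [hc] at hxC'
  exact eq_of_subset_of_isMember hCη hη1 hC'η' hη'1 (subset_of_subschemeι_genericPoint_mem C C' hxC')

end Good

/-! ## The successor state -/

section Successor

variable {X Y Y' : Scheme.{u}} [IsNoetherian X] [IsNoetherian Y] {σ : Y ⟶ X} {T : Set X} {x : Y}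
  {hx : IsClosed ({x} : Set Y)} {π : Y' ⟶ Y}

/-- **The successor state**: blowing up a closed point `x` on a member of a reachable configuration `(Y, σ, 𝒞)` gives a
reachable configuration on `Y'` — composition of point blow-ups over `T`, finite, members, `⋃ 𝒞' = (π ≫ σ)⁻¹ T`.
[cite: StacksProject, Tag 0BIC (Lemma 54.15.6, proof ¶1)] -/
theorem successor_state (hreg : Scheme.IsRegular X) (hexc : Scheme.IsExcellent X) (hX2 : topologicalKrullDim X ≤ 2)
    {𝒞 : Set (Closeds Y)} (hIPC : IsPointBlowupComposition T σ) (hfin : 𝒞.Finite)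
    (hmem : ∀ C ∈ 𝒞, ∃ η : Y, (C : Set Y) = closure {η} ∧ ¬ IsClosed ({η} : Set Y) ∧
      ringKrullDim (Y.presheaf.stalk η) = 1)
    (hU : (⋃ C ∈ 𝒞, (C : Set Y)) = σ ⁻¹' T) {C₀ : Closeds Y} (hC₀ : C₀ ∈ 𝒞) (hxC₀ : x ∈ (C₀ : Set Y))
    (hπ : IsBlowup π (vanishingIdeal ⟨{x}, hx⟩)) :
    IsPointBlowupComposition T (π ≫ σ) ∧
      ((fun C : Closeds Y => (⟨closure (π ⁻¹' ((C : Set Y) \ {x})), isClosed_closure⟩ : Closeds Y')) '' 𝒞 ∪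
          {⟨π ⁻¹' {x}, hx.preimage π.continuous⟩}).Finite ∧
      (∀ C' ∈ (fun C : Closeds Y => (⟨closure (π ⁻¹' ((C : Set Y) \ {x})), isClosed_closure⟩ : Closeds Y')) '' 𝒞 ∪
          {⟨π ⁻¹' {x}, hx.preimage π.continuous⟩},
        ∃ η : Y', (C' : Set Y') = closure {η} ∧ ¬ IsClosed ({η} : Set Y') ∧ ringKrullDim (Y'.presheaf.stalk η) = 1) ∧
      (⋃ C' ∈ (fun C : Closeds Y => (⟨closure (π ⁻¹' ((C : Set Y) \ {x})), isClosed_closure⟩ : Closeds Y')) '' 𝒞 ∪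
          {⟨π ⁻¹' {x}, hx.preimage π.continuous⟩}, (C' : Set Y')) = (π ≫ σ) ⁻¹' T := by
  obtain ⟨-, hregY, -, hY2⟩ := IsPointBlowupComposition.invariants hIPC hreg hexc hX2
  obtain ⟨η₀, hC₀η, hη₀cl, hη₀1⟩ := hmem C₀ hC₀
  have hx2 : ringKrullDim (Y.presheaf.stalk x) = 2 :=
    ringKrullDim_stalk_eq_two_of_mem_closure hY2 hη₀1 hx hη₀cl (hC₀η ▸ hxC₀)
  have hxne : ({x} : Set Y) ≠ Set.univ := by
    intro h
    have : η₀ ∈ ({x} : Set Y) := h ▸ Set.mem_univ _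
    rw [Set.mem_singleton_iff] at this
    exact hη₀cl (this ▸ hx)
  have hxT : σ x ∈ T := by
    rw [← Set.mem_preimage, ← hU]; exact Set.mem_biUnion hC₀ hxC₀
  haveI : IsProper π := hπ.isProper
  haveI : IsLocallyNoetherian Y' := LocallyOfFiniteType.isLocallyNoetherian π
  refine ⟨IsPointBlowupComposition.cons π σ x hx hIPC hxne hxT hπ, (hfin.image _).union (Set.finite_singleton _),
    ?_, ?_⟩
  · rintro C' (⟨C, hC, rfl⟩ | hC')
    · obtain ⟨η, hCη, hηcl, hη1⟩ := hmem C hC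
      obtain ⟨η', -, hst, hη'cl, hη'1⟩ := strictTransform_isMember hπ hη1 hηcl
      refine ⟨η', ?_, hη'cl, hη'1⟩
      change closure (π ⁻¹' ((C : Set Y) \ {x})) = closure {η'}
      rw [hCη, hst]
    · rw [Set.mem_singleton_iff] at hC'
      subst hC'
      obtain ⟨η', hE, hη'cl, hη'1⟩ := exceptional_isMember hregY hπ hx2
      exact ⟨η', hE, hη'cl, hη'1⟩
  · rw [Scheme.Hom.comp_base, TopCat.coe_comp, Set.preimage_comp, ← hU,
      ← biUnion_strictTransform_union_exceptional_eq π 𝒞 ⟨C₀, hC₀, hxC₀⟩, Set.biUnion_union,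
      Set.biUnion_image, Set.biUnion_singleton]
    rfl

omit [AlgebraicGeometry.IsNoetherian Y] in
/-- **GOOD persists**: if every member of `𝒞` is regular and distinct members meet transversally, the same holds for
the successor configuration after blowing up a closed point `x` on a member (C2: `E ⋔ C̃`; C3: `C̃` regular, `C̃ ⋔ C̃'`
off the fibre, `C̃ ∩ C̃' ∩ E = ∅`). [cite: StacksProject, Tag 0BIC (Lemma 54.15.6, proof ¶2)]
[cite: StacksProject, Tag 0BI7 (Lemma 54.15.3)] -/
theorem good_successor (hreg : Scheme.IsRegular X) (hexc : Scheme.IsExcellent X) (hX2 : topologicalKrullDim X ≤ 2)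
    {𝒞 : Set (Closeds Y)} (hIPC : IsPointBlowupComposition T σ)
    (hmem : ∀ C ∈ 𝒞, ∃ η : Y, (C : Set Y) = closure {η} ∧ ¬ IsClosed ({η} : Set Y) ∧
      ringKrullDim (Y.presheaf.stalk η) = 1)
    (hregC : ∀ C ∈ 𝒞, Scheme.IsRegular (vanishingIdeal C).subscheme)
    (htr : ∀ C ∈ 𝒞, ∀ C' ∈ 𝒞, C ≠ C' → ∀ q ∈ (C : Set Y) ∩ (C' : Set Y),
      stalkIdeal (vanishingIdeal C) q ⊔ stalkIdeal (vanishingIdeal C') q = maximalIdeal (Y.presheaf.stalk q))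
    (hπ : IsBlowup π (vanishingIdeal ⟨{x}, hx⟩)) :
    (∀ C' ∈ (fun C : Closeds Y => (⟨closure (π ⁻¹' ((C : Set Y) \ {x})), isClosed_closure⟩ : Closeds Y')) '' 𝒞 ∪
          {⟨π ⁻¹' {x}, hx.preimage π.continuous⟩}, Scheme.IsRegular (vanishingIdeal C').subscheme) ∧
      ∀ C' ∈ (fun C : Closeds Y => (⟨closure (π ⁻¹' ((C : Set Y) \ {x})), isClosed_closure⟩ : Closeds Y')) '' 𝒞 ∪
          {⟨π ⁻¹' {x}, hx.preimage π.continuous⟩},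
        ∀ D ∈ (fun C : Closeds Y => (⟨closure (π ⁻¹' ((C : Set Y) \ {x})), isClosed_closure⟩ : Closeds Y')) '' 𝒞 ∪
          {⟨π ⁻¹' {x}, hx.preimage π.continuous⟩}, C' ≠ D →
        ∀ q ∈ (C' : Set Y') ∩ (D : Set Y'),
          stalkIdeal (vanishingIdeal C') q ⊔ stalkIdeal (vanishingIdeal D) q = maximalIdeal (Y'.presheaf.stalk q) := by
  obtain ⟨hN, hregY, hexcY, hY2⟩ := IsPointBlowupComposition.invariants hIPC hreg hexc hX2
  haveI := hN
  have hqeY := hexcY.isQuasiExcellent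
  haveI : IsProper π := hπ.isProper
  haveI : IsLocallyNoetherian Y' := LocallyOfFiniteType.isLocallyNoetherian π
  -- member data
  have hprops : ∀ C ∈ 𝒞, IsIntegral (vanishingIdeal C).subscheme ∧ topologicalKrullDim (vanishingIdeal C).subscheme = 1 := by
    intro C hC
    obtain ⟨η, hCη, hηcl, hη1⟩ := hmem C hC
    have hCeq : C = ⟨closure {η}, isClosed_closure⟩ := Closeds.ext hCη
    obtain ⟨hint, -, -, hdim1⟩ := member_props hqeY hY2 hη1 hηcl
    rw [← hCeq] at hint hdim1
    exact ⟨hint, hdim1⟩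
  have hnsub : ∀ C ∈ 𝒞, ∀ C' ∈ 𝒞, C ≠ C' → ¬ (C : Set Y) ⊆ C' := by
    intro C hC C' hC' hne hsub
    obtain ⟨η, hCη, -, hη1⟩ := hmem C hC
    obtain ⟨η', hC'η', -, hη'1⟩ := hmem C' hC'
    exact hne (eq_of_subset_of_isMember hCη hη1 hC'η' hη'1 hsub)
  -- `E ⋔ C̃`
  have hEC : ∀ C ∈ 𝒞, ∀ q ∈ π ⁻¹' {x} ∩ closure (π ⁻¹' ((C : Set Y) \ {x})),
      stalkIdeal (vanishingIdeal (⟨π ⁻¹' {x}, hx.preimage π.continuous⟩ : Closeds Y')) q ⊔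
        stalkIdeal (vanishingIdeal (⟨closure (π ⁻¹' ((C : Set Y) \ {x})), isClosed_closure⟩ : Closeds Y')) q =
        maximalIdeal (Y'.presheaf.stalk q) := by
    intro C hC q hq
    obtain ⟨hint, hdim1⟩ := hprops C hC
    haveI := hint
    by_cases hxC : x ∈ (C : Set Y)
    · exact sup_stalkIdeal_exceptional_strictTransform_eq_maximalIdeal hregY hπ C hdim1 hxC
        (forall_not_mem_of_isRegular_subscheme C (hregC C hC) x) hq.1 hq.2
    · exfalso
      have hempty := closure_preimage_diff_inter_preimage_singleton_eq_empty π.continuous C hxC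
      exact (Set.eq_empty_iff_forall_notMem.mp hempty) q ⟨hq.2, hq.1⟩
  -- `C̃ ⋔ C̃'`
  have hCC : ∀ C ∈ 𝒞, ∀ C' ∈ 𝒞, C ≠ C' →
      ∀ q ∈ closure (π ⁻¹' ((C : Set Y) \ {x})) ∩ closure (π ⁻¹' ((C' : Set Y) \ {x})),
      stalkIdeal (vanishingIdeal (⟨closure (π ⁻¹' ((C : Set Y) \ {x})), isClosed_closure⟩ : Closeds Y')) q ⊔
        stalkIdeal (vanishingIdeal (⟨closure (π ⁻¹' ((C' : Set Y) \ {x})), isClosed_closure⟩ : Closeds Y')) q =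
        maximalIdeal (Y'.presheaf.stalk q) := by
    intro C hC C' hC' hne q hq
    obtain ⟨hint, hdim1⟩ := hprops C hC
    obtain ⟨hint', hdim1'⟩ := hprops C' hC'
    haveI := hint; haveI := hint'
    by_cases hqx : π q = x
    · exfalso
      have hxC : x ∈ (C : Set Y) := by
        by_contra hxC
        have hempty := closure_preimage_diff_inter_preimage_singleton_eq_empty π.continuous C hxC
        exact (Set.eq_empty_iff_forall_notMem.mp hempty) q ⟨hq.1, hqx⟩
      have hxC' : x ∈ (C' : Set Y) := by
        by_contra hxC'
        have hempty := closure_preimage_diff_inter_preimage_singleton_eq_empty π.continuous C' hxC'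
        exact (Set.eq_empty_iff_forall_notMem.mp hempty) q ⟨hq.2, hqx⟩
      have hempty := strictTransform_inter_strictTransform_inter_fibre_eq_empty hπ C C' hdim1 hdim1'
        (hnsub C hC C' hC' hne) hxC hxC' (forall_not_mem_of_isRegular_subscheme C (hregC C hC) x)
        (htr C hC C' hC' hne x ⟨hxC, hxC'⟩)
      exact (Set.eq_empty_iff_forall_notMem.mp hempty) q ⟨hq, hqx⟩
    · have hqC : π q ∈ (C : Set Y) := (mem_closure_preimage_diff_iff π.continuous C hqx).mp hq.1
      have hqC' : π q ∈ (C' : Set Y) := (mem_closure_preimage_diff_iff π.continuous C' hqx).mp hq.2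
      exact sup_stalkIdeal_strictTransform_eq_maximalIdeal_of_ne hπ C C' hdim1 hdim1' hqx
        (htr C hC C' hC' hne (π q) ⟨hqC, hqC'⟩)
  refine ⟨?_, ?_⟩
  · rintro C' (⟨C, hC, rfl⟩ | hC')
    · obtain ⟨hint, hdim1⟩ := hprops C hC
      haveI := hint
      exact isRegular_subscheme_strictTransform hπ C hdim1 (hregC C hC)
    · rw [Set.mem_singleton_iff] at hC'
      subst hC'
      exact isRegular_subscheme_exceptional hregY hπ
  · rintro C' (⟨C, hC, rfl⟩ | hC') D (⟨C₂, hC₂, rfl⟩ | hD) hne q hq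
    · have hCC₂ : C ≠ C₂ := by rintro rfl; exact hne rfl
      exact hCC C hC C₂ hC₂ hCC₂ q hq
    · rw [Set.mem_singleton_iff] at hD
      subst hD
      rw [sup_comm]
      exact hEC C hC q ⟨hq.2, hq.1⟩
    · rw [Set.mem_singleton_iff] at hC'
      subst hC'
      exact hEC C₂ hC₂ q hq
    · rw [Set.mem_singleton_iff] at hC' hD
      exact absurd (hC'.trans hD.symm) hne

end Successor

end F75c

end Summit.ResolutionOfSingularities.ResolutionOfSingularities.Theorems

end
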